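import Summits.BirchSwinnertonDyer.Rank1Residual.Additive.KobayashiTowerGeneration
import Summits.BirchSwinnertonDyer.Rank1Residual.Additive.CyclotomicTowerSignedGenerationReduction
import Literature.NumberTheory.EllipticCurves.FormalGroupDictionaryProofs
import HarnessLib

/-!
# `hsum` DISCHARGED from Honda theory: for a tower `U` whose local subgroups are the stabilisers of
# `ζ_{p^{n+1}}` and a curve with a good supersingular `a_p = 0` model at `p` odd, every layer satisfies
# `E(K_{n,v}) = E⁺(K_{n,v}) + E⁻(K_{n,v})` (Kobayashi Prop. 8.12 ii), generation half) — given no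
# `p`-power torsion in the `E(K_{n,v})` (Prop. 8.7, gen 32) and prime-to-`p` saturation of `E₁`
# (cell `b2b-bsdres`, CLASS-CLOSURE lane, class O10 — x1b GEN 33, class lead; file 36 of the local series)

HONEST FRAMING (cell `b2b-bsdres`, run/shared/lean/b2b/bsd-rank1-residual/, verbatim in every
file): the goal of the cell is to DELETE the COMBINATION-SHAPED residual classes of the
Birch–Swinnerton-Dyer formula for ALL analytic-rank `≤ 1` elliptic curves over `ℚ` — "full BSD
formula for every rank `≤ 1` curve in class `C`" assembled STRICTLY from published theorems — so
that the rank-`≤ 1` remainder becomes exactly the CONSTRUCTION-SHAPED classes, which are TYPED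
(missing-input `Prop`s), NOT attempted. This is not "finishing BSD". CLASS-CLOSURE lane: prove
what is provable now; shrink each hard class to its core with data; no claim beyond stated classes;
research routes on CONSTRUCTION-SHAPED X12 / O10; census / instrument output = EVIDENCE / conjecture
items, NEVER a Literature fact; `RESIDUAL-MAP.md` marks change only by signed lines. THIS FILE:
TOOL DEFINITION + THEOREMS over cc-typer-6's `localFixedPointsOfEmb` / `towerSignedLocalPointsOfEmb`
(one definition with body: `ptCast`, the identification of point groups along an EQUALITY of
Weierstrass equations; every statement proved) — no named Literature fact, no Summits-side fact
`def … : Prop`, no `sorry`, axioms standard; the remaining hypotheses are spelled out (`htors`: no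
`p`-power torsion, discharged by gen 32 for the concrete tower; `hsat`: prime-to-`p` saturation of
`E₁`, i.e. `#Ẽ_ns(k) ` prime to `p`); nothing is booked; no label / mark / count / sub-cell moves;
O10 stays OPEN / CONSTRUCTION-SHAPED; nothing about `BSD(W, p)` of any pair is claimed.

## Statement (`ι : K̄ → ℚ̄_p`, `W/K`, `U : ℕ → Subgroup Γ_K` antitone normal of finite index with
## LOCAL subgroups `(U n)_{ℚ_p} = Stab(ζ_{p^{n+1}})`, `M/ℤ_p` with `M ⊗ ℚ̄_p = W ⊗ ℚ̄_p`)

**`localFixedPointsOfEmb_le_sup_towerSigned`**: for every `n`,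
`E(K_{n,v}) ≤ E⁺(K_{n,v}) ⊔ E⁻(K_{n,v})` — the `hsum` hypothesis of files 1–8 of the O10 local series.
Proof: the reduction `le_sup_towerSigned_of_generators` (file CyclotomicTowerSignedGenerationReduction)
with Kobayashi's points `c n = c_{n+1}` (file KobayashiTowerPoints, transported along `ptCast`), their
trace relations (file KobayashiTowerGeneration §3), and the generation step (§2 there) combined with
the trivial bound `p·E(K_{n+1,v}) ⊆ E^ε ⊔ E(K_{n,v})` and Bezout for the prime-to-`p` saturation.

References: [Kobayashi2003] §8.4 (Lemma 8.9, Prop. 8.11, Prop. 8.12 ii)); [Honda1970] Thm. 2.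
-/

noncomputable section

open scoped Classical
open Finset

universe u

namespace Summit.BirchSwinnertonDyer.Rank1Residual.Additive

open Literature.NumberTheory.EllipticCurves Literature.NumberTheory.GaloisRepresentations
  Literature.NumberTheory.EllipticCurves.FormalGroupChart WeierstrassCurve PadicCyclotomicTower BallEval Field

/-! ## §1 Point groups along an equality of Weierstrass equations -/

/-- **Transport of points along an equality `V₁ = V₂` of Weierstrass equations** (an additive
equivalence; the identity on coordinates). [folklore] -/
def ptCast {F : Type*} [Field F] {V₁ V₂ : WeierstrassCurve F} (h : V₁ = V₂) :
    V₁.toAffine.Point ≃+ V₂.toAffine.Point :=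
  h ▸ AddEquiv.refl V₁.toAffine.Point

/-- `ptCast` on an affine point. [folklore] -/
theorem ptCast_some {F : Type*} [Field F] {V₁ V₂ : WeierstrassCurve F} (h : V₁ = V₂) {x y : F}
    (hxy : V₁.toAffine.Nonsingular x y) :
    ptCast h (.some x y hxy) = .some x y (h ▸ hxy) := by
  subst h; rfl

/-- `ptCast.symm` on an affine point. [folklore] -/
theorem ptCast_symm_some {F : Type*} [Field F] {V₁ V₂ : WeierstrassCurve F} (h : V₁ = V₂) {x y : F}
    (hxy : V₂.toAffine.Nonsingular x y) :
    (ptCast h).symm (.some x y hxy) = .some x y (h.symm ▸ hxy) := by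
  subst h; rfl

/-- Membership in `subfieldPoints` is invariant under `ptCast`. [folklore] -/
theorem ptCast_symm_mem_subfieldPoints_iff {F : Type*} [Field F] {V₁ V₂ : WeierstrassCurve F} (h : V₁ = V₂)
    (S : Subfield F) (h₁ : V₁.a₁ ∈ S ∧ V₁.a₂ ∈ S ∧ V₁.a₃ ∈ S ∧ V₁.a₄ ∈ S ∧ V₁.a₆ ∈ S)
    (P : V₂.toAffine.Point) :
    (ptCast h).symm P ∈ subfieldPoints V₁ S h₁ ↔
      ∀ (x y : F) (hxy : V₂.toAffine.Nonsingular x y), P = .some x y hxy → x ∈ S ∧ y ∈ S := by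
  subst h; exact Iff.rfl

/-- Membership in the kernel of reduction is invariant under `ptCast`. [folklore] -/
theorem ptCast_symm_mem_kernel_iff {F : Type*} [Field F] {w : Valuation F NNReal} {V₁ V₂ : WeierstrassCurve F}
    (h : V₁ = V₂) [h₁ : V₁.IsIntegral w.integer] (P : V₂.toAffine.Point) :
    (ptCast h).symm P ∈ kernel w V₁ ↔ ∀ (x y : F) (hxy : V₂.toAffine.Nonsingular x y), P = .some x y hxy → 1 < w x := by
  subst h; exact Iff.rfl

/-! ## §2 The setting and the transported action -/

section Main

variable {p : ℕ} [hp : Fact p.Prime] {K : Type} [Field K] [Algebra K ℚ_[p]]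
  (ι : AlgebraicClosure K →ₐ[K] AlgebraicClosure ℚ_[p]) (W : WeierstrassCurve K)
  (U : ℕ → Subgroup (Field.absoluteGaloisGroup K)) [hUf : ∀ n, (U n).FiniteIndex] [hUN : ∀ n, (U n).Normal]
  (M : WeierstrassCurve ℤ_[p])
  [hE : (M.map PadicInt.Coe.ringHom).IsElliptic] [hEt : (M.map PadicInt.toZMod).IsElliptic]

omit hE hEt in
/-- `(M ⊗ ℚ_p) ⊗ ℚ̄_p = M ⊗ ℚ̄_p`. [folklore] -/
theorem genFibΩ_eq_baseChange : genFibΩ p M = M.baseChange (AlgebraicClosure ℚ_[p]) := by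
  rw [genFibΩ, WeierstrassCurve.baseChange, WeierstrassCurve.baseChange, WeierstrassCurve.map_map,
    ← Literature.NumberTheory.EllipticCurves.algebraMap_padicInt_eq, ← IsScalarTower.algebraMap_eq]

variable {W M} in
/-- **The identification `E_Ω-points ≃ E(K̄_{ℚ_p})`** (cc-typer-6's `localPoints W ℚ_[p]`) along
`(M ⊗ ℚ_p) ⊗ ℚ̄_p = W ⊗ ℚ̄_p`. [folklore] -/
def toLoc (hV : genFibΩ p M = W.baseChange (AlgebraicClosure ℚ_[p])) :
    (genFibΩ p M).toAffine.Point ≃+ localPoints W ℚ_[p] :=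
  ptCast hV

variable {W M} in
omit hE hEt in
/-- Kernel membership read through `toLoc`. [folklore] -/
theorem toLoc_symm_mem_kernel_iff (hV : genFibΩ p M = W.baseChange (AlgebraicClosure ℚ_[p]))
    [h₁ : (genFibΩ p M).IsIntegral (Valued.v (R := PadicAlgCl p)).integer] (P : localPoints W ℚ_[p]) :
    (toLoc hV).symm P ∈ kernel (Valued.v (R := PadicAlgCl p)) (genFibΩ p M) ↔
      ∀ (x y : AlgebraicClosure ℚ_[p]) (hxy : (W.baseChange (AlgebraicClosure ℚ_[p])).toAffine.Nonsingular x y),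
        P = .some x y hxy → 1 < Valued.v x :=
  ptCast_symm_mem_kernel_iff hV P

variable {W M} in
omit hE hEt in
/-- The transported Galois action on `E_Ω`-points is coordinatewise. [folklore] -/
theorem act_some (hV : genFibΩ p M = W.baseChange (AlgebraicClosure ℚ_[p]))
    (σ : Field.absoluteGaloisGroup ℚ_[p]) (x y : PadicAlgCl p) (h : (genFibΩ p M).toAffine.Nonsingular x y) :
    ∃ h', (toLoc hV).symm (σ • toLoc hV (.some x y h)) = .some (σ • x) (σ • y) h' := by
  have e1 : toLoc hV (.some x y h) =
      (Affine.Point.some x y (hV ▸ h) : (W.baseChange (AlgebraicClosure ℚ_[p])).toAffine.Point) := ptCast_some hV h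
  refine ⟨(Affine.baseChange_nonsingular (W := (M.map (PadicInt.Coe.ringHom (p := p))).toAffine)
    (f := ((Field.absoluteGaloisGroup.toAlgEquiv ℚ_[p] σ : PadicAlgCl p ≃ₐ[ℚ_[p]] PadicAlgCl p) :
      PadicAlgCl p →ₐ[ℚ_[p]] PadicAlgCl p)) (AlgEquiv.injective _) x y).mpr h, ?_⟩
  rw [e1, localPoints.smul_def, Affine.Point.map_some]
  exact ptCast_symm_some hV _

variable {W M} in
omit hE hEt in
/-- The transported action fixes `O`. [folklore] -/
theorem act_zero (hV : genFibΩ p M = W.baseChange (AlgebraicClosure ℚ_[p])) (σ : Field.absoluteGaloisGroup ℚ_[p]) :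
    (toLoc hV).symm (σ • toLoc hV 0) = 0 := by
  rw [map_zero, smul_zero, map_zero]

variable {ι W M} in
omit hE hEt in
/-- **`E(K_{n,v})`-membership is "coordinates in the layer"**: a local point is fixed by `stab p m` iff
its preimage in `E_Ω` has coordinates in `layer p m`. [cite: Kobayashi2003, §2 p. 4] -/
theorem forall_smul_eq_iff_mem_subfieldPoints (hV : genFibΩ p M = W.baseChange (AlgebraicClosure ℚ_[p]))
    (m : ℕ) (P : localPoints W ℚ_[p]) :
    (∀ τ ∈ stab p m, τ • P = P) ↔
      (toLoc hV).symm P ∈ subfieldPoints (genFibΩ p M) (layer p m).toSubfield coeffs_mem_layer := by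
  obtain ⟨Q, rfl⟩ : ∃ Q, P = toLoc hV Q := ⟨(toLoc hV).symm P, ((toLoc hV).apply_symm_apply P).symm⟩
  rw [AddEquiv.symm_apply_apply]
  constructor
  · intro h
    refine mem_subfieldPoints_of_forall_act_eq (fun σ Q' => (toLoc hV).symm (σ • toLoc hV Q')) (act_some hV)
      fun τ hτ => ?_
    rw [h τ hτ, AddEquiv.symm_apply_apply]
  · intro hQ τ hτ
    rcases Q with _ | ⟨x, y, hxy⟩
    · rw [show (Affine.Point.zero : (genFibΩ p M).toAffine.Point) = 0 from rfl, map_zero, smul_zero]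
    · obtain ⟨hx, hy⟩ := (some_mem_subfieldPoints_iff _ hxy).mp hQ
      obtain ⟨h', e⟩ := act_some hV τ x y hxy
      have e' : τ • toLoc hV (.some x y hxy) = toLoc hV (.some (τ • x) (τ • y) h') := by
        rw [← e, AddEquiv.apply_symm_apply]
      rw [e']
      congr 1
      rw [Affine.Point.some.injEq]
      exact ⟨smul_eq_self_of_mem_stab hτ hx, smul_eq_self_of_mem_stab hτ hy⟩

variable {W M U} in
omit hE hEt hUf hUN in
/-- `E(K_{n,v}) = L(n+1)` under `(U n)_{ℚ_p} = Stab(ζ_{p^{n+1}})`. [cite: Kobayashi2003, §2 p. 4] -/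
theorem mem_localFixedPointsOfEmb_iff_mem_subfieldPoints (hV : genFibΩ p M = W.baseChange (AlgebraicClosure ℚ_[p]))
    (hU : ∀ n, localSubgroupOfEmb (U n) ι = stab p (n + 1)) (n : ℕ) (P : localPoints W ℚ_[p]) :
    P ∈ localFixedPointsOfEmb ι W (U n) ↔
      (toLoc hV).symm P ∈ subfieldPoints (genFibΩ p M) (layer p (n + 1)).toSubfield coeffs_mem_layer := by
  rw [mem_localFixedPointsOfEmb_iff, hU, ← forall_smul_eq_iff_mem_subfieldPoints hV]

variable {W M} in
omit hE hEt in
/-- `E(K_{−1,v}) = E(ℚ_p) = L(0)`. [cite: Kobayashi2003, §2 p. 4] -/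
theorem mem_localFixedPointsOfEmb_top_iff_mem_subfieldPoints (hV : genFibΩ p M = W.baseChange (AlgebraicClosure ℚ_[p]))
    (P : localPoints W ℚ_[p]) :
    P ∈ localFixedPointsOfEmb ι W ⊤ ↔
      (toLoc hV).symm P ∈ subfieldPoints (genFibΩ p M) (layer p 0).toSubfield coeffs_mem_layer := by
  rw [mem_localFixedPointsOfEmb_top_iff, ← forall_smul_eq_iff_mem_subfieldPoints hV 0]
  simp only [stab_zero, Subgroup.mem_top, forall_const]

/-! ## §3 The discharge of `hsum` -/

variable {ι W U M}

/-- **`hsum` from Honda theory (Kobayashi Prop. 8.12 ii), generation half).** Let `U` be an antitone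
tower of normal finite-index subgroups of `Γ_K` whose LOCAL subgroups at `ι` are the stabilisers
`Stab(ζ_{p^{n+1}}) ≤ Gal(ℚ̄_p/ℚ_p)` (`K_{n,v} = ℚ_p(ζ_{p^{n+1}})`), `p` odd, `W/K` with a model `M/ℤ_p` of
good supersingular reduction with `a_p(M) = 0` and `M ⊗ ℚ̄_p = W ⊗ ℚ̄_p`. Assume (i) `htors`: no
`E(K_{n,v})` has non-trivial `p`-power torsion (Prop. 8.7; gen 32 for the cyclotomic tower) and (ii)
`hsat`: every `P ∈ E(K_{n,v})` has a prime-to-`p` multiple in `E₁` (reduction modulo `p`). Then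
`E(K_{n,v}) ≤ E⁺(K_{n,v}) ⊔ E⁻(K_{n,v})` for every `n`. [cite: Kobayashi2003, Prop. 8.12] -/
theorem localFixedPointsOfEmb_le_sup_towerSigned (hp2 : p ≠ 2)
    (htr : Literature.NumberTheory.EllipticCurves.HasseManin.tr (M.map PadicInt.toZMod) = 0)
    (hUa : Antitone U) (hU : ∀ n, localSubgroupOfEmb (U n) ι = stab p (n + 1))
    (hWM : M.baseChange (AlgebraicClosure ℚ_[p]) = W.baseChange (AlgebraicClosure ℚ_[p]))
    (htors : ∀ n, ∀ P ∈ localFixedPointsOfEmb ι W (U n), ∀ k : ℕ, p ^ k • P = 0 → P = 0)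
    (hsat : ∀ n, ∀ P ∈ localFixedPointsOfEmb ι W (U n), ∃ m' : ℕ, m'.Coprime p ∧
      ∀ (x y : AlgebraicClosure ℚ_[p]) (hxy : (W.baseChange (AlgebraicClosure ℚ_[p])).toAffine.Nonsingular x y),
        m' • P = .some x y hxy → 1 < ‖x‖)
    (n : ℕ) :
    localFixedPointsOfEmb ι W (U n) ≤
      towerSignedLocalPointsOfEmb U ι W 1 n ⊔ towerSignedLocalPointsOfEmb U ι W (-1) n := by
  have hV : genFibΩ p M = W.baseChange (AlgebraicClosure ℚ_[p]) := (genFibΩ_eq_baseChange M).trans hWM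
  haveI hintΩ : (genFibΩ p M).IsIntegral (Valued.v (R := PadicAlgCl p)).integer := isIntegral_genFib_baseChange p M
  -- notation
  set e := toLoc hV with he
  set act : Field.absoluteGaloisGroup ℚ_[p] → (genFibΩ p M).toAffine.Point → (genFibΩ p M).toAffine.Point :=
    fun σ Q => e.symm (σ • e Q) with hact_def
  have hact0 : ∀ σ, act σ 0 = 0 := fun σ => act_zero hV σ
  have hact : ∀ σ (x y : PadicAlgCl p) (h : (genFibΩ p M).toAffine.Nonsingular x y),
      ∃ h', act σ (Affine.Point.some x y h) = Affine.Point.some (σ • x) (σ • y) h' := fun σ x y h => act_some hV σ x y h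
  have he_act : ∀ σ Q, e (act σ Q) = σ • e Q := fun σ Q => by
    simp only [hact_def, AddEquiv.apply_symm_apply]
  -- layer points and the fixed groups
  have hFix : ∀ k (P : localPoints W ℚ_[p]), P ∈ localFixedPointsOfEmb ι W (U k) ↔
      e.symm P ∈ subfieldPoints (genFibΩ p M) (layer p (k + 1)).toSubfield coeffs_mem_layer :=
    fun k P => mem_localFixedPointsOfEmb_iff_mem_subfieldPoints ι hV hU k P
  have hFixTop : ∀ (P : localPoints W ℚ_[p]), P ∈ localFixedPointsOfEmb ι W ⊤ ↔
      e.symm P ∈ subfieldPoints (genFibΩ p M) (layer p 0).toSubfield coeffs_mem_layer :=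
    fun P => mem_localFixedPointsOfEmb_top_iff_mem_subfieldPoints ι hV P
  -- no `p`-power torsion on `L(m)` for `m ≥ 1`
  have htorsΩ : ∀ m, 1 ≤ m → ∀ Q ∈ subfieldPoints (genFibΩ p M) (layer p m).toSubfield coeffs_mem_layer,
      ∀ k : ℕ, p ^ k • Q = 0 → Q = 0 := by
    intro m hm Q hQ k hk
    obtain ⟨m₀, rfl⟩ := Nat.exists_eq_add_of_le' hm
    have hQ' : (e Q : localPoints W ℚ_[p]) ∈ localFixedPointsOfEmb ι W (U m₀) := by
      rw [hFix]; simpa using hQ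
    have := htors m₀ (e Q) hQ' k (by rw [← map_nsmul, hk, map_zero])
    exact e.injective (by rw [this, map_zero])
  -- Kobayashi's points, transported
  set c : ℕ → localPoints W ℚ_[p] := fun k => e (cPt p M hp2 htr (k + 1)) with hc_def
  have hc : ∀ k, c k ∈ localFixedPointsOfEmb ι W (U k) := fun k => by
    rw [hFix, hc_def]; simp only [AddEquiv.symm_apply_apply]; exact cPt_mem_subfieldPoints _
  -- finiteness of the Galois quotients
  have hfin : ∀ m, ((stab p (m + 1)).subgroupOf (stab p m)).FiniteIndex := fun m => by
    refine ⟨?_⟩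
    rw [index_subgroupOf_stab_succ]
    split_ifs
    · have := hp.out.two_le; omega
    · exact hp.out.ne_zero
  haveI hFt : ∀ m, Fintype (stab p m ⧸ (stab p (m + 1)).subgroupOf (stab p m)) := fun m =>
    haveI := hfin m; Fintype.ofFinite _
  -- the traces of cc-typer-6, computed over `stab p (k+1) / stab p (k+2)`
  have htrace : ∀ k (Q : (genFibΩ p M).toAffine.Point),
      Q ∈ subfieldPoints (genFibΩ p M) (layer p (k + 2)).toSubfield coeffs_mem_layer →
      localPairTraceOfEmb ι W (U k) (U (k + 1)) (e Q) =
        e (∑ q : stab p (k + 1) ⧸ (stab p (k + 2)).subgroupOf (stab p (k + 1)),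
          act ((q.out : stab p (k + 1)) : Field.absoluteGaloisGroup ℚ_[p]) Q) := by
    intro k Q hQ
    have hQ' : (e Q : localPoints W ℚ_[p]) ∈ localFixedPointsOfEmb ι W (U (k + 1)) := by
      rw [hFix]; simpa using hQ
    have hmem : ∀ τ : Field.absoluteGaloisGroup ℚ_[p], τ ∈ stab p (k + 1) → τ ∈ localSubgroupOfEmb (U k) ι :=
      fun τ hτ => by rw [hU]; exact hτ
    have hmem' : ∀ τ : Field.absoluteGaloisGroup ℚ_[p], τ ∈ localSubgroupOfEmb (U (k + 1)) ι ↔ τ ∈ stab p (k + 2) :=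
      fun τ => by rw [hU]
    let g : (stab p (k + 1) ⧸ (stab p (k + 2)).subgroupOf (stab p (k + 1))) → localSubgroupOfEmb (U k) ι :=
      fun q => ⟨((q.out : stab p (k + 1)) : Field.absoluteGaloisGroup ℚ_[p]), hmem _ q.out.2⟩
    have hg : Function.Bijective fun q => (QuotientGroup.mk (g q) :
        localSubgroupOfEmb (U k) ι ⧸ (localSubgroupOfEmb (U (k + 1)) ι).subgroupOf (localSubgroupOfEmb (U k) ι)) := by
      constructor
      · intro q₁ q₂ hq
        have hq' := QuotientGroup.eq.mp hq
        rw [Subgroup.mem_subgroupOf, Subgroup.coe_mul, Subgroup.coe_inv, hmem'] at hq'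
        rw [← QuotientGroup.out_eq' q₁, ← QuotientGroup.out_eq' q₂, QuotientGroup.eq, Subgroup.mem_subgroupOf,
          Subgroup.coe_mul, Subgroup.coe_inv]
        exact hq'
      · intro r
        obtain ⟨τ, rfl⟩ := QuotientGroup.mk_surjective r
        have hiff : ∀ σ : Field.absoluteGaloisGroup ℚ_[p], σ ∈ localSubgroupOfEmb (U k) ι ↔ σ ∈ stab p (k + 1) :=
          fun σ => by rw [hU]
        have hτ : (τ : Field.absoluteGaloisGroup ℚ_[p]) ∈ stab p (k + 1) := (hiff _).mp τ.2
        refine ⟨QuotientGroup.mk ⟨τ, hτ⟩, ?_⟩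
        change QuotientGroup.mk (g (QuotientGroup.mk ⟨(τ : Field.absoluteGaloisGroup ℚ_[p]), hτ⟩)) = QuotientGroup.mk τ
        rw [QuotientGroup.eq, Subgroup.mem_subgroupOf, Subgroup.coe_mul, Subgroup.coe_inv, hmem']
        have h2 : (((QuotientGroup.mk (s := (stab p (k + 2)).subgroupOf (stab p (k + 1)))
            ⟨(τ : Field.absoluteGaloisGroup ℚ_[p]), hτ⟩).out : stab p (k + 1)) : Field.absoluteGaloisGroup ℚ_[p])⁻¹ *
            τ ∈ stab p (k + 2) := by
          have h3 := QuotientGroup.mk_out_eq_mul (s := (stab p (k + 2)).subgroupOf (stab p (k + 1)))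
            (⟨(τ : Field.absoluteGaloisGroup ℚ_[p]), hτ⟩ : stab p (k + 1))
          obtain ⟨h, hh⟩ := h3
          have hh' := congrArg (fun z : stab p (k + 1) => (z : Field.absoluteGaloisGroup ℚ_[p])) hh
          simp only [Subgroup.coe_mul] at hh'
          rw [hh']
          have hhm : ((h : stab p (k + 1)) : Field.absoluteGaloisGroup ℚ_[p]) ∈ stab p (k + 2) := by
            have := h.2; rw [Subgroup.mem_subgroupOf] at this; exact this
          rw [mul_inv_rev, mul_assoc, inv_mul_cancel, mul_one]
          exact (stab p (k + 2)).inv_mem hhm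
        exact h2
    rw [localPairTraceOfEmb_eq_sum_of_bijective ι W (U k) (U (k + 1)) hQ' g hg, map_sum]
    exact sum_congr rfl fun q _ => (he_act _ Q).symm
  -- trace relations
  have h1 : localPairTraceOfEmb ι W (U 0) (U 1) (c 1) ∈ localFixedPointsOfEmb ι W ⊤ := by
    rw [hc_def]
    rw [htrace 0 (cPt p M hp2 htr 2) (cPt_mem_subfieldPoints 2), hFixTop, AddEquiv.symm_apply_apply]
    have h := sum_act_cPt_add_mem (hp2 := hp2) (htr := htr) act hact0 hact (m := 1) le_rfl (htorsΩ 2 (by omega))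
    rwa [show (1 : ℕ) - 1 = 0 from rfl, cPt_zero, add_zero] at h
  have hrel : ∀ k, localPairTraceOfEmb ι W (U (k + 1)) (U (k + 2)) (c (k + 2)) + c k ∈ localFixedPointsOfEmb ι W ⊤ := by
    intro k
    rw [hc_def]
    rw [htrace (k + 1) (cPt p M hp2 htr (k + 3)) (cPt_mem_subfieldPoints (k + 3)), ← map_add, hFixTop,
      AddEquiv.symm_apply_apply]
    have h := sum_act_cPt_add_mem (hp2 := hp2) (htr := htr) act hact0 hact (m := k + 2) (by omega) (htorsΩ (k + 3) (by omega))
    exact h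
  -- generation
  have hgen : ∀ k, ∀ P ∈ localFixedPointsOfEmb ι W (U (k + 1)),
      ∃ B ∈ AddSubgroup.closure (Set.range fun g : Field.absoluteGaloisGroup ℚ_[p] => g • c (k + 1)),
        P - B ∈ towerSignedLocalPointsOfEmb U ι W (((k + 1 : ℕ) : ℤ).negOnePow) (k + 1) ⊔
          localFixedPointsOfEmb ι W (U k) := by
    intro k P hP
    set S := towerSignedLocalPointsOfEmb U ι W (((k + 1 : ℕ) : ℤ).negOnePow) (k + 1) ⊔ localFixedPointsOfEmb ι W (U k)
      with hS
    -- the index `[K_{k+1,v} : K_{k,v}] = p`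
    have hidx : ((localSubgroupOfEmb (U (k + 1)) ι).subgroupOf (localSubgroupOfEmb (U k) ι)).index = p := by
      rw [hU (k + 1), hU k, index_subgroupOf_stab_succ, if_neg (by omega)]
    have htriv : ∀ R ∈ localFixedPointsOfEmb ι W (U (k + 1)), p • R ∈ S := fun R hR => by
      have h := index_smul_mem_sup U ι W hUa k hR
      rwa [hidx] at h
    -- saturation
    obtain ⟨m', hm'p, hm'⟩ := hsat (k + 1) P hP
    set Q := e.symm P with hQdef
    have hQL : Q ∈ subfieldPoints (genFibΩ p M) (layer p (k + 2)).toSubfield coeffs_mem_layer := (hFix (k + 1) P).mp hP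
    have hmQk : m' • Q ∈ kernel (Valued.v (R := PadicAlgCl p)) (genFibΩ p M) := by
      rw [hQdef, ← map_nsmul, he, toLoc_symm_mem_kernel_iff]
      intro x y hxy hxP
      have := hm' x y hxy hxP
      rwa [PadicAlgCl.valuation_def, ← NNReal.coe_lt_coe, coe_nnnorm, NNReal.coe_one]
    obtain ⟨BΩ, hBΩ, RΩ, hRΩL, -, hgenΩ⟩ := exists_sub_closure_sub_smul_mem (hp2 := hp2) (htr := htr) act hact0 hact
      (m := k + 2) (by omega)
      (htorsΩ (k + 2) (by omega)) ((subfieldPoints _ _ _).nsmul_mem hQL m') hmQk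
    rw [show k + 2 - 1 = k + 1 from rfl] at hgenΩ
    -- transport back
    set B : localPoints W ℚ_[p] := e BΩ with hBdef
    set R : localPoints W ℚ_[p] := e RΩ with hRdef
    have hBcl : B ∈ AddSubgroup.closure (Set.range fun g : Field.absoluteGaloisGroup ℚ_[p] => g • c (k + 1)) := by
      have himg : (AddSubgroup.closure (Set.range fun σ : Field.absoluteGaloisGroup ℚ_[p] =>
          act σ (cPt p M hp2 htr (k + 2)))).map e.toAddMonoidHom ≤
          AddSubgroup.closure (Set.range fun g : Field.absoluteGaloisGroup ℚ_[p] => g • c (k + 1)) := by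
        rw [AddMonoidHom.map_closure]
        refine AddSubgroup.closure_mono ?_
        rintro _ ⟨_, ⟨σ, rfl⟩, rfl⟩
        exact ⟨σ, (he_act σ _).symm⟩
      exact himg ⟨BΩ, hBΩ, rfl⟩
    have hR : R ∈ localFixedPointsOfEmb ι W (U (k + 1)) := by
      rw [hFix, hRdef, AddEquiv.symm_apply_apply]; exact hRΩL
    have hF : m' • P - B - p • R ∈ localFixedPointsOfEmb ι W (U k) := by
      rw [hFix, map_sub, map_sub, map_nsmul, map_nsmul, hBdef, hRdef, AddEquiv.symm_apply_apply,
        AddEquiv.symm_apply_apply]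
      exact hgenΩ
    -- Bezout
    obtain ⟨a, b, hab⟩ := Nat.isCoprime_iff_coprime.mpr hm'p
    refine ⟨a • B, AddSubgroup.zsmul_mem _ hBcl a, ?_⟩
    have hFS : m' • P - B - p • R ∈ S := AddSubgroup.mem_sup_right hF
    have hpR : p • R ∈ S := htriv R hR
    have hpP : p • P ∈ S := htriv P hP
    have key : P - a • B = a • (m' • P - B - p • R) + a • (p • R) + b • (p • P) := by
      have hP1 : P = (a * (m' : ℤ) + b * (p : ℤ)) • P := by rw [hab, one_zsmul]
      conv_lhs => rw [hP1]
      rw [add_zsmul, mul_zsmul, mul_zsmul, natCast_zsmul, natCast_zsmul, smul_sub, smul_sub]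
      abel
    rw [key]
    exact S.add_mem (S.add_mem (S.zsmul_mem hFS a) (S.zsmul_mem hpR a)) (S.zsmul_mem hpP b)
  exact le_sup_towerSigned_of_generators U ι W hUa c hc h1 hrel hgen n

end Main

end Summit.BirchSwinnertonDyer.Rank1Residual.Additive

end
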